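import Literature.Barriers.SmoothPoincare4.ExoticContractibleUniverseProofs
import Literature.Topology.FourManifolds.HCobordismDonaldson
import Literature.Topology.FourManifolds.MappingTorusSymmProofs
import HarnessLib

/-!
# Barrier (SmoothPoincare4), corks: the cork fact from the cork decomposition theorem

Fifth sibling proof file of `Literature/Barriers/SmoothPoincare4/ExoticContractible.lean` (fact
seat `provefact-Literature.Barriers.SmoothPoincare4.akbulut1991_mazurCork`), for the named fact
`Literature.Barriers.SmoothPoincare4.akbulut1991_mazurCork` ("a cork exists": a compact
contractible smooth 4-manifold `W` and a self-diffeomorphism of `∂W` extending to a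
self-homeomorphism but to no self-diffeomorphism of `W`; S. Akbulut, *A fake compact contractible
4-manifold*, J. Differential Geom. 33 (1991) 335–356, Thms. 1–2). Everything here is proved; no
definition and no named fact is introduced.

## Why

The tree carries two renderings of the cork theorem (Matveyev 1996; Curtis–Freedman–Hsiang–Stong
1996):

* the two-piece form `Literature.Topology.FourManifolds.Matveyev1996_decomposition`
  (`CorkDecomposition.lean`: `X₁ = W₁ ∪_{φ₁} M`, `X₂ = W₂ ∪_{φ₂} M`, `W₁ ≅ W₂`, the common exterior
  `M` a compact Hausdorff second countable smooth 4-manifold with boundary), and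
* the one-piece (cork twist) form `Literature.Topology.FourManifolds.corkDecomposition`
  (`CorkTwist.lean`: `X₂` is the cork twist of `X₁` along a compact contractible `(C, τ)`,
  `Literature.Topology.FourManifolds.IsCorkTwist`, whose exterior `W` carries only a topology, an
  atlas on the half-space model and a boundary datum).

The second is the weaker statement (`corkDecomposition_of_matveyev1996`) and it is the one the
tree's whole programme on the cork theorem concludes (`corkDecomposition_of_partOne_and_fact`,
`corkDecomposition_of_middleLevel_leaves`, `corkDecomposition_of_milnor1965_leaves`,
`corkDecomposition_of_two_three`, `corkDecomposition_of_frontier`, … in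
`Literature/Topology/FourManifolds/CorkDecomposition*.lean`, `SeamAdaptedWitnesses.lean`,
`CorkTwistProofs.lean`), whereas the existing routes from the cork theorem to the cork fact
(`akbulut1991_mazurCork_of_corkTheorem`, `ExoticContractibleCorkTheoremProofs.lean`;
`akbulut1991_mazurCork_of_matveyev_donaldson_freedmanQuinn`, `ExoticContractibleUniverseProofs.lean`)
consume the first: the step "an extension of `τ` over `C` would make the twist trivial" rests on
the uniqueness of gluings (Hirsch, *Differential Topology* (1976), Ch. 8 §2, Thm. 2.1; the tree's
theorem `Literature.Topology.FourManifolds.nonempty_diffeomorph_of_isBoundaryGluing_holds`), which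
needs the exterior to be a compact Hausdorff smooth manifold. This file closes the gap:

* §1 (general, any dimension): **the pieces of a gluing along the boundary inherit the regularity
  of the glued manifold** — if `P = M ∪_φ N` (`Literature.Topology.FourManifolds.IsBoundaryGluing`)
  then `M`, `N` are Hausdorff, resp. second countable, when `P` is (they are embedded in `P`);
  their atlases are automatically `C^∞`-compatible (sources of `C^∞` immersions, the tree's
  `Literature.Topology.FourManifolds.isManifold_of_isImmersion`); and they are compact when `P`
  is (each piece is CLOSED in `P`, its complement being the open image of the interior of the
  other piece: the tree's `Literature.Topology.FourManifolds.BoundaryGluingData.isClosedEmbedding_jA/jB`,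
  `BoundaryGluingData.lean`). Declared as dot-notation lemmas
  `Literature.Topology.FourManifolds.IsBoundaryGluing.t2Space_left/right`, `…secondCountableTopology_left/right`,
  `…isManifold_left/right`, `…compactSpace_left/right` (absolute names, CONVENTIONS §2).
* §2: **`corkDecomposition` and an h-cobordant non-diffeomorphic pair of simply connected closed
  smooth 4-manifolds give a compact contractible smooth `C` with a boundary diffeomorphism `τ`
  extending to no self-diffeomorphism of `C`** (`exists_not_extendsToDiffeomorph_of_corkDecomposition`):
  the exterior of the cork twist is upgraded by §1 and the tree's
  `not_extendsToDiffeomorph_of_isEmpty_diffeomorph` applies with Hirsch's uniqueness theorem.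
* §3: **the cork fact `akbulut1991_mazurCork.{u}` (every universe) from `corkDecomposition.{0}`,
  the exotic h-cobordant pair `Literature.Topology.FourManifolds.exists_isHCobordant_isEmpty_diffeomorph_four`
  and Freedman–Quinn 11.1C** (`akbulut1991_mazurCork_of_corkDecomposition_zero`; same-universe form
  `akbulut1991_mazurCork_of_corkDecomposition`), and — through the tree's proved assembly
  `Literature.Topology.FourManifolds.exists_isHCobordant_isEmpty_diffeomorph_four_of_wall_of_akhmedovPark`
  (`HCobordismDonaldson.lean`) — **from `corkDecomposition.{0}`, Wall's theorem
  (`Literature.Topology.FourManifolds.isHCobordant_and_exists_isStabilization`), the Akhmedov–Park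
  family (`akhmedovPark2010_exotic_bTwo_three`) and Freedman–Quinn**
  (`akbulut1991_mazurCork_of_corkDecomposition_wall_akhmedovPark`); the same for the barrier
  `RelativeContractibleBarrierFour`.

So the discharge of the cork fact along the cork-theorem route is now reduced to the discharge
of `corkDecomposition` (any of the tree's routes into it), of an exotic pair (Wall ∧ Akhmedov–Park,
or Donaldson's pair directly) and of Freedman–Quinn 11.1C; the involutivity of `τ` (Kirby 1996,
Addendum; Akbulut–Matveyev 1998), which the smooth leaf `akbulut1991_notExtendsToDiffeomorph`
records, is NOT obtained along this route and is not needed for the fact.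

## References

* S. Akbulut, *A fake compact contractible 4-manifold*, J. Differential Geom. 33 (1991) 335–356,
  Thms. 1–2. [Akbulut1991Fake]
* R. Matveyev, *A decomposition of smooth simply-connected h-cobordant 4-manifolds*,
  J. Differential Geom. 44 (1996) 571–582, Theorem. [Matveyev1996]
* S. Akbulut, K. Yasui, *Corks, plugs and exotic structures*, J. Gökova Geom. Topol. 2 (2008)
  40–82, §1 (the cork theorem [M], [C]) and Def. 2.1. [AkbulutYasui2008]
* M. W. Hirsch, *Differential Topology*, GTM 33 (1976), Ch. 8 §2, Thm. 2.1. [HirschDT1976]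
* M. H. Freedman, F. Quinn, *Topology of 4-manifolds* (1990), Prop. 11.1C, Cor. 9.3C. [FreedmanQuinn1990]
* S. K. Donaldson, *Irrationality and the h-cobordism conjecture*, J. Differential Geom. 26 (1987)
  141–168, p. 142. [DonaldsonIrrationality1987]
-/

noncomputable section

open scoped Manifold ContDiff
open Function Set
open _root_.Topology
open Literature.Topology.FourManifolds

universe u w

/-! ### §1 The pieces of a gluing along the boundary inherit the regularity of the glued manifold -/

namespace Literature.Topology.FourManifolds

section Pieces

variable {n : ℕ} {M N : Type u} [TopologicalSpace M] [ChartedSpace (EuclideanHalfSpace (n + 1)) M]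
  [TopologicalSpace N] [ChartedSpace (EuclideanHalfSpace (n + 1)) N]
  {bM : BoundaryData (𝓡∂ (n + 1)) M (𝓡 n)} {bN : BoundaryData (𝓡∂ (n + 1)) N (𝓡 n)}
  {P : Type w} [TopologicalSpace P] [ChartedSpace (EuclideanSpace ℝ (Fin (n + 1))) P]

/-- The second piece of a gluing `P = M ∪_φ N` into a Hausdorff `P` is Hausdorff (it is
embedded in `P`). [folklore] -/
theorem IsBoundaryGluing.t2Space_right [T2Space P] {φ : bM.carrier → bN.carrier}
    (h : IsBoundaryGluing bM bN φ (𝓡 (n + 1)) P) : T2Space N := by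
  obtain ⟨_, jB, -, hB, -, -⟩ := h
  exact hB.isEmbedding.t2Space

/-- The first piece of a gluing `P = M ∪_φ N` into a Hausdorff `P` is Hausdorff. [folklore] -/
theorem IsBoundaryGluing.t2Space_left [T2Space P] {φ : bM.carrier → bN.carrier}
    (h : IsBoundaryGluing bM bN φ (𝓡 (n + 1)) P) : T2Space M := by
  obtain ⟨jA, _, hA, -, -, -⟩ := h
  exact hA.isEmbedding.t2Space

/-- The second piece of a gluing `P = M ∪_φ N` into a second countable `P` is second countable.
[folklore] -/
theorem IsBoundaryGluing.secondCountableTopology_right [SecondCountableTopology P]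
    {φ : bM.carrier → bN.carrier} (h : IsBoundaryGluing bM bN φ (𝓡 (n + 1)) P) :
    SecondCountableTopology N := by
  obtain ⟨_, jB, -, hB, -, -⟩ := h
  exact hB.isEmbedding.secondCountableTopology

/-- The first piece of a gluing `P = M ∪_φ N` into a second countable `P` is second countable.
[folklore] -/
theorem IsBoundaryGluing.secondCountableTopology_left [SecondCountableTopology P]
    {φ : bM.carrier → bN.carrier} (h : IsBoundaryGluing bM bN φ (𝓡 (n + 1)) P) :
    SecondCountableTopology M := by
  obtain ⟨jA, _, hA, -, -, -⟩ := h
  exact hA.isEmbedding.secondCountableTopology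

/-- **The atlas of a piece of a gluing is `C^∞`-compatible**: the second piece of
`P = M ∪_φ N` is a `C^∞` manifold with boundary for its given charted structure, being the source
of a `C^∞` immersion (the tree's `isManifold_of_isImmersion`: the domain charts of Mathlib's
`Manifold.IsImmersionAt` lie in the maximal atlas and cover the source). [folklore] -/
theorem IsBoundaryGluing.isManifold_right {φ : bM.carrier → bN.carrier}
    (h : IsBoundaryGluing bM bN φ (𝓡 (n + 1)) P) : IsManifold (𝓡∂ (n + 1)) ∞ N := by
  obtain ⟨_, jB, -, hB, -, -⟩ := h
  exact isManifold_of_isImmersion hB.isImmersion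

/-- The first piece of `P = M ∪_φ N` is a `C^∞` manifold with boundary for its given charted
structure. [folklore] -/
theorem IsBoundaryGluing.isManifold_left {φ : bM.carrier → bN.carrier}
    (h : IsBoundaryGluing bM bN φ (𝓡 (n + 1)) P) : IsManifold (𝓡∂ (n + 1)) ∞ M := by
  obtain ⟨jA, _, hA, -, -, -⟩ := h
  exact isManifold_of_isImmersion hA.isImmersion

/-- **A piece of a gluing of a compact manifold is compact**: if `P = M ∪_φ N` with `P` a
compact `C^∞` manifold (and `φ` a bijection of the boundaries), the second piece `N` is compact —
it is a closed subset of `P`, the complement of its image being the open image of the interior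
of `M` (equidimensional immersions are open on interior points; the tree's
`BoundaryGluingData.isClosedEmbedding_jB`). [folklore] -/
theorem IsBoundaryGluing.compactSpace_right [CompactSpace P] [IsManifold (𝓡 (n + 1)) ∞ P]
    {φ : bM.carrier ≃ bN.carrier} (h : IsBoundaryGluing bM bN φ (𝓡 (n + 1)) P) :
    CompactSpace N := by
  haveI : IsManifold (𝓡∂ (n + 1)) ∞ M := h.isManifold_left
  obtain ⟨G⟩ := h.nonempty_boundaryGluingData
  exact G.isClosedEmbedding_jB.compactSpace

/-- The first piece of a gluing `P = M ∪_φ N` of a compact `C^∞` manifold `P` along a bijection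
of the boundaries is compact. [folklore] -/
theorem IsBoundaryGluing.compactSpace_left [CompactSpace P] [IsManifold (𝓡 (n + 1)) ∞ P]
    {φ : bM.carrier ≃ bN.carrier} (h : IsBoundaryGluing bM bN φ (𝓡 (n + 1)) P) :
    CompactSpace M :=
  IsBoundaryGluing.compactSpace_right (φ := φ.symm) h.symm

/-- `IsBoundaryGluing.compactSpace_right` for a gluing *diffeomorphism* (the form used
downstream). [folklore] -/
theorem IsBoundaryGluing.compactSpace_right' [CompactSpace P] [IsManifold (𝓡 (n + 1)) ∞ P]
    {φ : bM.carrier ≃ₘ⟮𝓡 n, 𝓡 n⟯ bN.carrier} (h : IsBoundaryGluing bM bN φ (𝓡 (n + 1)) P) :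
    CompactSpace N :=
  IsBoundaryGluing.compactSpace_right (φ := φ.toEquiv) h

/-- `IsBoundaryGluing.compactSpace_left` for a gluing *diffeomorphism*. [folklore] -/
theorem IsBoundaryGluing.compactSpace_left' [CompactSpace P] [IsManifold (𝓡 (n + 1)) ∞ P]
    {φ : bM.carrier ≃ₘ⟮𝓡 n, 𝓡 n⟯ bN.carrier} (h : IsBoundaryGluing bM bN φ (𝓡 (n + 1)) P) :
    CompactSpace M :=
  IsBoundaryGluing.compactSpace_left (φ := φ.toEquiv) h

end Pieces

/-- **The exterior of a cork twist of a closed manifold is a compact Hausdorff second countable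
smooth 4-manifold with boundary.** If `X'` is the cork twist of `X` along `(C, τ)`
(`IsCorkTwist`), with `X` a compact Hausdorff second countable `C^∞` 4-manifold, then the
relation is witnessed by an exterior `W` which is Hausdorff, second countable, compact and `C^∞`
(these being inherited from `X = C ∪_φ W`, §1) — i.e. `IsCorkTwist` loses nothing by recording
only a topology, an atlas and a boundary datum on the exterior. [folklore] -/
theorem IsCorkTwist.exists_exterior {C : Type u} [TopologicalSpace C]
    [ChartedSpace (EuclideanHalfSpace 4) C] {bC : BoundaryData (𝓡∂ 4) C (𝓡 3)}
    {τ : bC.carrier ≃ₘ⟮𝓡 3, 𝓡 3⟯ bC.carrier}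
    {X : Type u} [TopologicalSpace X] [T2Space X] [SecondCountableTopology X]
    [ChartedSpace (EuclideanSpace ℝ (Fin 4)) X] [IsManifold (𝓡 4) ∞ X] [CompactSpace X]
    {EX' HX' : Type*} [NormedAddCommGroup EX'] [NormedSpace ℝ EX'] [TopologicalSpace HX']
    {IX' : ModelWithCorners ℝ EX' HX'} {X' : Type*} [TopologicalSpace X'] [ChartedSpace HX' X']
    (h : IsCorkTwist bC τ (𝓡 4) X IX' X') :
    ∃ (W : Type u) (_ : TopologicalSpace W) (_ : T2Space W) (_ : SecondCountableTopology W)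
      (_ : ChartedSpace (EuclideanHalfSpace 4) W) (_ : IsManifold (𝓡∂ 4) ∞ W) (_ : CompactSpace W)
      (bW : BoundaryData (𝓡∂ 4) W (𝓡 3)) (φ : bC.carrier ≃ₘ⟮𝓡 3, 𝓡 3⟯ bW.carrier),
      IsBoundaryGluing bC bW φ (𝓡 4) X ∧ IsBoundaryGluing bC bW (τ.trans φ) IX' X' := by
  obtain ⟨W, _, _, bW, φ, hX, hX'⟩ := h
  exact ⟨W, ‹_›, hX.t2Space_right, hX.secondCountableTopology_right, ‹_›, hX.isManifold_right,
    hX.compactSpace_right', bW, φ, hX, hX'⟩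

end Literature.Topology.FourManifolds

namespace Literature.Barriers.SmoothPoincare4

/-! ### §2 A non-extending boundary diffeomorphism from `corkDecomposition` and an exotic pair -/

/-- **Cork decomposition + an exotic h-cobordant pair ⇒ the smooth content of a cork.** If the
cork decomposition theorem holds in the one-piece form `corkDecomposition` (Matveyev 1996;
Curtis–Freedman–Hsiang–Stong 1996) and some simply connected closed smooth 4-manifolds `M`, `N`
are h-cobordant but not diffeomorphic, then there are a compact (Hausdorff, second countable)
contractible smooth 4-manifold `C` with boundary datum `b` and a self-diffeomorphism `τ` of `∂C`
extending to NO self-diffeomorphism of `C`: `N` is the cork twist of `M` along some `(C, τ)`,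
`M = C ∪_φ W`, `N = C ∪_{φ ∘ τ} W`; the exterior `W` is a compact Hausdorff smooth manifold
(`IsCorkTwist.exists_exterior`), so if `τ` extended over `C` the two gluings would be
diffeomorphic by uniqueness of gluings (Hirsch, Thm. 8.2.1, the tree's theorem
`nonempty_diffeomorph_of_isBoundaryGluing_holds`, through
`not_extendsToDiffeomorph_of_isEmpty_diffeomorph`). Compare
`exists_not_extendsToDiffeomorph_of_exoticPair` (same conclusion from the two-piece form
`Matveyev1996_decomposition`). Involutivity of `τ` is not obtained.
[cite: Matveyev1996, Theorem] [cite: AkbulutYasui2008, §1 (the cork theorem [M], [C])] [cite: HirschDT1976, Ch. 8 §2, Thm. 2.1] -/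
theorem exists_not_extendsToDiffeomorph_of_corkDecomposition
    (hCD : corkDecomposition.{u})
    (hD : ∃ (M N : Type u) (_ : TopologicalSpace M) (_ : T2Space M) (_ : SecondCountableTopology M)
      (_ : ChartedSpace (EuclideanSpace ℝ (Fin 4)) M) (_ : IsManifold (𝓡 4) ∞ M)
      (_ : CompactSpace M) (_ : SimplyConnectedSpace M)
      (_ : TopologicalSpace N) (_ : T2Space N) (_ : SecondCountableTopology N)
      (_ : ChartedSpace (EuclideanSpace ℝ (Fin 4)) N) (_ : IsManifold (𝓡 4) ∞ N)
      (_ : CompactSpace N) (_ : SimplyConnectedSpace N),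
      IsHCobordant 4 M N ∧ IsEmpty (M ≃ₘ⟮𝓡 4, 𝓡 4⟯ N)) :
    ∃ (C : Type u) (_ : TopologicalSpace C) (_ : T2Space C) (_ : SecondCountableTopology C)
      (_ : ChartedSpace (EuclideanHalfSpace 4) C) (_ : IsManifold (𝓡∂ 4) ∞ C) (_ : CompactSpace C)
      (_ : ContractibleSpace C) (b : BoundaryData (𝓡∂ 4) C (𝓡 3))
      (τ : b.carrier ≃ₘ⟮𝓡 3, 𝓡 3⟯ b.carrier), ¬ ExtendsToDiffeomorph b τ := by
  obtain ⟨M, N, _, _, _, _, _, _, _, _, _, _, _, _, _, _, hH, hne⟩ := hD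
  obtain ⟨C, _, _, _, _, _, bC, τ, hc, hk, hT⟩ := hCD M N hH
  haveI : CompactSpace C := hc
  haveI : ContractibleSpace C := hk
  obtain ⟨W, _, _, _, _, _, _, bW, φ, hX, hX'⟩ := hT.exists_exterior
  exact ⟨C, ‹_›, ‹_›, ‹_›, ‹_›, ‹_›, hc, hk, bC, τ,
    not_extendsToDiffeomorph_of_isEmpty_diffeomorph nonempty_diffeomorph_of_isBoundaryGluing_holds
      hX hX' hne⟩

/-! ### §3 Assembly: the cork fact and the relative barrier from `corkDecomposition` -/

/-- **Corks exist, from the cork decomposition theorem, an exotic h-cobordant pair and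
Freedman–Quinn** (one universe): the smooth content
(`exists_not_extendsToDiffeomorph_of_corkDecomposition`) and the topological half (`hF`: the
boundary diffeomorphism of a compact contractible smooth 4-manifold extends to a
self-homeomorphism, `extendsToHomeomorph_of_freedmanQuinn`). The witness is a cork of the given
exotic pair, not necessarily Akbulut's Mazur cork (the fact is an existence statement).
[cite: AkbulutYasui2008, §1 (the cork theorem [M], [C])] [cite: FreedmanQuinn1990, Prop. 11.1C (trivial group)] [cite: Akbulut1991Fake, Thms. 1-2] -/
theorem akbulut1991_mazurCork_of_corkDecomposition
    (hCD : corkDecomposition.{u})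
    (hD : ∃ (M N : Type u) (_ : TopologicalSpace M) (_ : T2Space M) (_ : SecondCountableTopology M)
      (_ : ChartedSpace (EuclideanSpace ℝ (Fin 4)) M) (_ : IsManifold (𝓡 4) ∞ M)
      (_ : CompactSpace M) (_ : SimplyConnectedSpace M)
      (_ : TopologicalSpace N) (_ : T2Space N) (_ : SecondCountableTopology N)
      (_ : ChartedSpace (EuclideanSpace ℝ (Fin 4)) N) (_ : IsManifold (𝓡 4) ∞ N)
      (_ : CompactSpace N) (_ : SimplyConnectedSpace N),
      IsHCobordant 4 M N ∧ IsEmpty (M ≃ₘ⟮𝓡 4, 𝓡 4⟯ N))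
    (hF : freedmanQuinn1990_homeomorph_extends_contractible.{u}) :
    akbulut1991_mazurCork.{u} := by
  obtain ⟨C, _, _, _, _, _, _, _, b, τ, hτ⟩ :=
    exists_not_extendsToDiffeomorph_of_corkDecomposition hCD hD
  exact ⟨C, ‹_›, ‹_›, ‹_›, ‹_›, ‹_›, ‹_›, ‹_›, b, τ, extendsToHomeomorph_of_freedmanQuinn hF b τ, hτ⟩

/-- **The cork fact at every universe from `corkDecomposition.{0}`, the Donaldson–Freedman–Wall
exotic h-cobordant pair (`exists_isHCobordant_isEmpty_diffeomorph_four`, stated over `Type`) and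
Freedman–Quinn 11.1C at universe `0`** (`akbulut1991_mazurCork_of_corkDecomposition` and the
universe lift `akbulut1991_mazurCork_of_universe_zero`). Compare
`akbulut1991_mazurCork_of_matveyev_donaldson_freedmanQuinn` (the two-piece form of the cork
theorem in place of `corkDecomposition`).
[cite: AkbulutYasui2008, §1 (the cork theorem [M], [C])] [cite: FreedmanQuinn1990, Prop. 11.1C (trivial group)] [cite: DonaldsonIrrationality1987, p. 142] -/
theorem akbulut1991_mazurCork_of_corkDecomposition_zero
    (hCD : corkDecomposition.{0})
    (hD : exists_isHCobordant_isEmpty_diffeomorph_four)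
    (hF : freedmanQuinn1990_homeomorph_extends_contractible.{0}) :
    akbulut1991_mazurCork.{u} :=
  akbulut1991_mazurCork_of_universe_zero (akbulut1991_mazurCork_of_corkDecomposition hCD hD hF)

/-- **The cork fact at every universe from four ACCEPTED named facts of the tree**:
`corkDecomposition.{0}` (the cork theorem), Wall's theorem
(`isHCobordant_and_exists_isStabilization`: isomorphic intersection forms ⇒ h-cobordant, Wall
1964 Thms. 2–3), the Akhmedov–Park family (`akhmedovPark2010_exotic_bTwo_three`: homeomorphic,
pairwise non-diffeomorphic simply connected closed smooth 4-manifolds) and Freedman–Quinn 11.1C —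
the exotic h-cobordant pair being assembled from Wall and Akhmedov–Park by the tree's
`exists_isHCobordant_isEmpty_diffeomorph_four_of_wall_of_akhmedovPark` (Donaldson 1987, p. 142:
"Wall showed … that there is an h-cobordism between two simply connected, homotopy equivalent
4-manifolds").
[cite: AkbulutYasui2008, §1 (the cork theorem [M], [C])] [cite: DonaldsonIrrationality1987, p. 142] [cite: FreedmanQuinn1990, Prop. 11.1C (trivial group)] -/
theorem akbulut1991_mazurCork_of_corkDecomposition_wall_akhmedovPark
    (hCD : corkDecomposition.{0})
    (hW : isHCobordant_and_exists_isStabilization)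
    (hAP : akhmedovPark2010_exotic_bTwo_three)
    (hF : freedmanQuinn1990_homeomorph_extends_contractible.{0}) :
    akbulut1991_mazurCork.{u} :=
  akbulut1991_mazurCork_of_corkDecomposition_zero hCD
    (exists_isHCobordant_isEmpty_diffeomorph_four_of_wall_of_akhmedovPark hW hAP) hF

/-- **`RelativeContractibleBarrierFour` at every universe from `corkDecomposition.{0}`, the
exotic h-cobordant pair and Freedman–Quinn** (`relativeContractibleBarrierFour_of_akbulut`).
[cite: AkbulutYasui2008, §1 (the cork theorem [M], [C])] [cite: AkbulutRuberman2016, §1] -/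
theorem relativeContractibleBarrierFour_of_corkDecomposition_zero
    (hCD : corkDecomposition.{0})
    (hD : exists_isHCobordant_isEmpty_diffeomorph_four)
    (hF : freedmanQuinn1990_homeomorph_extends_contractible.{0}) :
    RelativeContractibleBarrierFour.{u} :=
  relativeContractibleBarrierFour_of_akbulut (akbulut1991_mazurCork_of_corkDecomposition_zero hCD hD hF)

/-- **`RelativeContractibleBarrierFour` at every universe from `corkDecomposition.{0}`, Wall,
Akhmedov–Park and Freedman–Quinn.**
[cite: AkbulutYasui2008, §1 (the cork theorem [M], [C])] [cite: AkbulutRuberman2016, §1] -/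
theorem relativeContractibleBarrierFour_of_corkDecomposition_wall_akhmedovPark
    (hCD : corkDecomposition.{0})
    (hW : isHCobordant_and_exists_isStabilization)
    (hAP : akhmedovPark2010_exotic_bTwo_three)
    (hF : freedmanQuinn1990_homeomorph_extends_contractible.{0}) :
    RelativeContractibleBarrierFour.{u} :=
  relativeContractibleBarrierFour_of_akbulut
    (akbulut1991_mazurCork_of_corkDecomposition_wall_akhmedovPark hCD hW hAP hF)

end Literature.Barriers.SmoothPoincare4

end
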